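import Literature.Geometry.Symplectic.ZeroCircleAdaptedChartPos
import Literature.Geometry.Symplectic.AxisGluingEstimate
import Literature.Geometry.Symplectic.AxisGluingPushforward
import Literature.Geometry.Symplectic.TubeChartOrientation
import Literature.Geometry.Symplectic.NearSymplecticTwoCirclesReductionStrict
import HarnessLib

/-!
# Honda's normal form along an even zero circle (Perutz 2006, Lemma 3.1), strict version

Topic `Geometry/Symplectic`; namespace `Literature.Geometry.Symplectic`.  Theorems only; no named
fact, no `sorry`.  The hypothesis (H') of
`relNearSymplecticTaubesTubes_exists_of_twoEvenCircles_of_hondaNormalForm_strict`, PROVED: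
on a `4`-manifold `M` (Hausdorff, σ-compact) with a smooth orientation `o`, every strictly
`o`-near-symplectic form `sf` with an even zero circle `γ` can be replaced, inside any open
`N ⊇ γ(ℝ)`, by a strictly `o`-near-symplectic form `sf'` with `sf' = sf` off `N`, the same zero
locus, and a Honda model chart of some radius inside `N` with axis image `γ(ℝ)`
(`hondaNormalForm_strict`).  Assembly of

* the adapted chart with positive sign (`IsEvenZeroCircle.exists_adaptedChart_pos`, Perutz's
  step 1),
* the model-level gluing with positivity (`exists_axisGluing`, steps 2–3 with a logarithmic
  cut-off in place of the Moser flow),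
* the push-forward of the glued model form along the chart (`exists_pushforwardForm`),
* the orientation bookkeeping along the tube (`tubeChart_orientation_of_isPositiveZero`).

Consequence: `relNearSymplecticTaubesTubes_exists_of_twoEvenCircles` — the fact
`relNearSymplecticTaubesTubes_exists` follows from (G') alone (Gerig 2021, Thm. 1.6: two even
zero circles on a punctured homotopy sphere).

## References

* T. Perutz, *Zero-sets of near-symplectic forms*, J. Symplectic Geom. 4 (2006), Lemma 3.1.
  [Perutz2006]
* K. Honda, *Local properties of self-dual harmonic 2-forms on a 4-manifold*, J. reine angew.
  Math. 577 (2004), Thm. 5. [Honda2004LocalSD]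
* C. Gerig, *No homotopy 4-sphere invariants using ECH=SWF*, (2021), Thm. 1.6.
  [Gerig2021NoHomotopySphereInvariants]
-/

noncomputable section

open scoped Manifold ContDiff Topology Real Matrix
open Set Function Filter Module Real Matrix Literature.Topology.FourManifolds
  Literature.Geometry.Kaehler Literature.Analysis.Matrix

namespace Literature.Geometry.Symplectic

universe u

variable {M : Type u} [TopologicalSpace M] [ChartedSpace (EuclideanSpace ℝ (Fin 4)) M]
  [IsManifold (𝓡 4) ∞ M]

/-! ### Congruence of the pointwise notions under local equality of forms -/

/-- `IsWedgeSqPos` only depends on the value of the form. [folklore] -/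
theorem isWedgeSqPos_congr {o : SmoothOrientation (𝓡 4) M} {α β : MForm (𝓡 4) M ℝ 2} {x : M}
    (h : α x = β x) : IsWedgeSqPos o α x ↔ IsWedgeSqPos o β x := by
  unfold IsWedgeSqPos; rw [h]

/-! ### The pulled-back form as model data -/

/-- **`χ^*sf` is closed on the tube** (as an identity for Mathlib's `extDeriv`), for `sf` smooth
and closed and `χ` smooth on the tube. [folklore] -/
theorem extDeriv_pullback_eq_zero {sf : MForm (𝓡 4) M ℝ 2} {χ : EuclideanSpace ℝ (Fin 4) → M}
    {r : ℝ} (hsm : IsSmoothForm sf) (hcl : IsClosedForm sf)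
    (hχs : ContMDiffOn 𝓘(ℝ, EuclideanSpace ℝ (Fin 4)) (𝓡 4) ∞ χ (hondaTube r))
    {q : EuclideanSpace ℝ (Fin 4)} (hq : q ∈ hondaTube r) :
    extDeriv (fun y ↦ (sf.pullback 𝓘(ℝ, EuclideanSpace ℝ (Fin 4)) χ y :
      (EuclideanSpace ℝ (Fin 4)) [⋀^Fin 2]→L[ℝ] ℝ)) q = 0 := by
  have hχ := eventually_contMDiffAt_of_mem_hondaTube hχs hq
  have h1 := mextDeriv_pullback_apply (I := 𝓘(ℝ, EuclideanSpace ℝ (Fin 4))) hχ (hsm (χ q))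
  have h2 := mextDeriv_eq_extDeriv (sf.pullback 𝓘(ℝ, EuclideanSpace ℝ (Fin 4)) χ) q
  show extDeriv (sf.pullback 𝓘(ℝ, EuclideanSpace ℝ (Fin 4)) χ) q = 0
  rw [← h2, h1, show mextDeriv sf = 0 from hcl]
  ext v
  rfl

omit [IsManifold (𝓡 4) ∞ M] in
/-- `χ^*sf` is `2π`-periodic (as `Λ²`-valued map) when `χ` is (everywhere: at points where
`χ` is not differentiable both sides vanish). [folklore] -/
theorem pullback_periodic {sf : MForm (𝓡 4) M ℝ 2} {χ : EuclideanSpace ℝ (Fin 4) → M}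
    (hper : ∀ q, χ (q + (2 * π) • EuclideanSpace.single 0 1) = χ q)
    (q : EuclideanSpace ℝ (Fin 4)) :
    (sf.pullback 𝓘(ℝ, EuclideanSpace ℝ (Fin 4)) χ (q + (2 * π) • EuclideanSpace.single 0 1) :
      (EuclideanSpace ℝ (Fin 4)) [⋀^Fin 2]→L[ℝ] ℝ) =
      sf.pullback 𝓘(ℝ, EuclideanSpace ℝ (Fin 4)) χ q := by
  by_cases hd : MDifferentiableAt 𝓘(ℝ, EuclideanSpace ℝ (Fin 4)) (𝓡 4) χ
      (q + (2 * π) • EuclideanSpace.single 0 1)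
  · ext v
    exact pullback_apply_add_eq_of_forall hper hd v
  · -- neither point is a differentiability point: both `mfderiv`s vanish
    have hd' : ¬ MDifferentiableAt 𝓘(ℝ, EuclideanSpace ℝ (Fin 4)) (𝓡 4) χ q := by
      intro h
      apply hd
      have hT' : HasMFDerivAt 𝓘(ℝ, EuclideanSpace ℝ (Fin 4)) 𝓘(ℝ, EuclideanSpace ℝ (Fin 4))
          (fun y : EuclideanSpace ℝ (Fin 4) ↦ y + (-(2 * π)) • EuclideanSpace.single 0 1)
          (q + (2 * π) • EuclideanSpace.single 0 1)
          (ContinuousLinearMap.id ℝ (EuclideanSpace ℝ (Fin 4))) :=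
        ((hasFDerivAt_id _).add_const _).hasMFDerivAt
      have hq0 : (q + (2 * π) • EuclideanSpace.single 0 1) +
          (-(2 * π)) • EuclideanSpace.single (0 : Fin 4) (1 : ℝ) = q := by
        rw [neg_smul, add_neg_cancel_right]
      have h' : MDifferentiableAt 𝓘(ℝ, EuclideanSpace ℝ (Fin 4)) (𝓡 4) χ
          ((q + (2 * π) • EuclideanSpace.single 0 1) +
            (-(2 * π)) • EuclideanSpace.single (0 : Fin 4) (1 : ℝ)) := by rw [hq0]; exact h
      have h2 : MDifferentiableAt 𝓘(ℝ, EuclideanSpace ℝ (Fin 4)) (𝓡 4)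
          (χ ∘ fun y : EuclideanSpace ℝ (Fin 4) ↦ y + (-(2 * π)) • EuclideanSpace.single 0 1)
          (q + (2 * π) • EuclideanSpace.single 0 1) :=
        (h'.hasMFDerivAt.comp (q + (2 * π) • EuclideanSpace.single 0 1) hT').mdifferentiableAt
      have heq : (χ ∘ fun y : EuclideanSpace ℝ (Fin 4) ↦ y + (-(2 * π)) • EuclideanSpace.single 0 1)
          = χ := by
        funext y
        simp only [Function.comp_apply]
        have := hper (y + (-(2 * π)) • EuclideanSpace.single 0 1)
        rw [neg_smul, neg_add_cancel_right] at this
        rw [neg_smul]; exact this.symm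
      rwa [heq] at h2
    ext v
    change sf (χ (q + (2 * π) • EuclideanSpace.single 0 1))
        (fun i ↦ mfderiv 𝓘(ℝ, EuclideanSpace ℝ (Fin 4)) (𝓡 4) χ
          (q + (2 * π) • EuclideanSpace.single 0 1) (v i)) =
      sf (χ q) (fun i ↦ mfderiv 𝓘(ℝ, EuclideanSpace ℝ (Fin 4)) (𝓡 4) χ q (v i))
    rw [mfderiv_zero_of_not_mdifferentiableAt hd, mfderiv_zero_of_not_mdifferentiableAt hd']
    have h0 : ∀ (a : M) (w : Fin 2 → TangentSpace (𝓡 4) a), (∀ i, w i = 0) → sf a w = 0 :=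
      fun a w hw ↦ (sf a).map_coord_zero 0 (hw 0)
    exact (h0 _ _ fun _ ↦ rfl).trans (h0 _ _ fun _ ↦ rfl).symm

section Main

variable [T2Space M] [SigmaCompactSpace M]

set_option maxHeartbeats 3200000 in
/-- **Honda's normal form along an even zero circle, strict version = hypothesis (H') of the
two-circle reduction** (Perutz 2006, Lemma 3.1 with its footnote; Honda 2004, Thm. 5):
see the module docstring. [cite: Perutz2006, Lemma 3.1] -/
theorem hondaNormalForm_strict (o : SmoothOrientation (𝓡 4) M) (sf : MForm (𝓡 4) M ℝ 2)
    (γ : ℝ → M) (N : Set M) (hsf : IsStrictlyNearSymplectic o sf) (h : IsEvenZeroCircle sf γ)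
    (hN : IsOpen N) (hγN : range γ ⊆ N) :
    ∃ (sf' : MForm (𝓡 4) M ℝ 2) (r : ℝ) (χ : EuclideanSpace ℝ (Fin 4) → M),
      IsStrictlyNearSymplectic o sf' ∧ (∀ x : M, x ∉ N → sf' x = sf x) ∧
      zeroLocus sf' = zeroLocus sf ∧ 0 < r ∧ IsHondaModelChartIn N r sf' χ ∧
      χ '' hondaAxis = range γ := by
  -- Step 1: the adapted chart with positive sign
  obtain ⟨r, χ, Mb, hr, hper, hχs, hχinj, hχimm, hχN, hax, hZ, hMs, hsymm, hblock, hneg, hpos,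
    hMP, hjet⟩ := h.exists_adaptedChart_pos o hsf hN hγN
  have hsm : IsSmoothForm sf := hsf.isSmoothForm
  have hcl : IsClosedForm sf := hsf.isClosedForm
  have hopen := isOpen_hondaTube r
  -- zeros of `sf` on the axis
  have haxZ : ∀ q ∈ hondaAxis, sf (χ q) = 0 := by
    intro q hq
    have : χ q ∈ range γ := hax ▸ ⟨q, hq, rfl⟩
    obtain ⟨θ, hθ⟩ := this
    rw [← hθ]
    exact h.isZeroCircle.apply_eq_zero θ
  -- Step 2: the model data `G = χ^* sf`
  set G : EuclideanSpace ℝ (Fin 4) → (EuclideanSpace ℝ (Fin 4)) [⋀^Fin 2]→L[ℝ] ℝ :=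
    fun y ↦ sf.pullback 𝓘(ℝ, EuclideanSpace ℝ (Fin 4)) χ y with hG
  have hGs : ContDiffOn ℝ ∞ G (hondaTube r) := contDiffOn_pullback_hondaTube hχs hsm
  have hGper : ∀ q, G (q + (2 * π) • EuclideanSpace.single (0 : Fin 4) (1 : ℝ)) = G q :=
    fun q ↦ pullback_periodic hper q
  have hGcl : ∀ q ∈ hondaTube r, extDeriv G q = 0 := fun q hq ↦
    extDeriv_pullback_eq_zero hsm hcl hχs hq
  have hG0 : ∀ θ, G (hondaAxisPoint θ) = 0 := fun θ ↦
    pullback_apply_eq_zero (haxZ _ (hondaAxisPoint_mem_hondaAxis θ))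
  have hMc : ∀ i j, Continuous fun θ ↦ Mb θ i j := fun i j ↦ (hMs i j).continuous
  -- Step 3: the model-level gluing
  obtain ⟨r₀, r₁, G', hr₀, hr₀₁, hr₁r, hG's, hG'cl, hG'per, hG'eq, hG'core, hG'pos, hG'0⟩ :=
    exists_axisGluing hr hGs hGper hGcl hG0 hMc hMP hsymm hblock hneg hpos hjet
  have hr₁ : 0 < r₁ := by linarith
  have hr₀r₁ : r₀ < r₁ := by linarith
  have hsub₁ : hondaTube r₁ ⊆ hondaTube r := hondaTube_mono hr₁.le hr₁r.le
  have hsub₀ : hondaTube r₀ ⊆ hondaTube r₁ := hondaTube_mono hr₀.le hr₀r₁.le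
  have hχs₁ := hχs.mono hsub₁
  have hχinj₁ : ∀ q ∈ hondaTube r₁, ∀ q' ∈ hondaTube r₁, χ q' = χ q →
      ∃ k : ℤ, q' = q + (2 * π * k) • EuclideanSpace.single 0 1 :=
    fun q hq q' hq' hqq ↦ hχinj q (hsub₁ hq) q' (hsub₁ hq') hqq
  have hχimm₁ : ∀ q ∈ hondaTube r₁,
      Injective (mfderiv 𝓘(ℝ, EuclideanSpace ℝ (Fin 4)) (𝓡 4) χ q) := fun q hq ↦ hχimm q (hsub₁ hq)
  -- Step 4: the push-forward
  obtain ⟨sf', hpull, hcoreEq, hcoreClosed, hcoreSub, hsm', hcl'⟩ :=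
    exists_pushforwardForm (sf := sf) hr₁ hper hχs₁ hχinj₁ hχimm₁ (hG's.mono hsub₁) hG'per
      (fun q hq ↦ hG'cl q (hsub₁ hq)) (fun q _ hfar ↦ hG'eq q hfar)
  -- Step 5: the orientation base point on the axis
  have hdist : Continuous fun q : EuclideanSpace ℝ (Fin 4) ↦ ‖q - hondaAxisPoint (q 0)‖ := by
    obtain ⟨L, hL⟩ := exists_normalProjCLM
    have : (fun q : EuclideanSpace ℝ (Fin 4) ↦ ‖q - hondaAxisPoint (q 0)‖) = fun q ↦ ‖L q‖ :=
      funext fun q ↦ by rw [hL]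
    rw [this]; exact continuous_norm.comp L.continuous
  have ha₀ : hondaAxisPoint 0 ∈ hondaTube r₁ := hondaAxisPoint_mem_hondaTube hr₁ 0
  have h0base : sf (χ (hondaAxisPoint 0)) = 0 := haxZ _ (hondaAxisPoint_mem_hondaAxis 0)
  have hpzbase : IsPositiveZero o sf (χ (hondaAxisPoint 0)) := by
    rcases hsf.isStrictlyNearPositive (χ (hondaAxisPoint 0)) with hw | hp
    · exact absurd (mem_zeroLocus.2 h0base) hw.not_mem_zeroLocus
    · exact hp
  have hWbase : 0 < pfaffian (zeroGradient (sf.pullback 𝓘(ℝ, EuclideanSpace ℝ (Fin 4)) χ)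
      (hondaAxisPoint 0) (stdVec 1)) := by
    rw [zeroGradient_eq_fderiv_model]
    have hj := hjet 0 (stdVec 1)
    simp only [hG] at hj
    rw [hj, pfaffian_betaForm]
    set x₀ : Fin 3 → ℝ := normalPart (stdVec 1 : EuclideanSpace ℝ (Fin 4)) with hx₀
    have hx₀v : x₀ = ![1, 0, 0] := by
      funext k; fin_cases k <;> simp [hx₀, normalPart_apply, stdVec]
    have hne : Mb 0 *ᵥ x₀ ≠ 0 := by
      intro h0
      have hx2 : x₀ 2 = 0 := by rw [hx₀v]; rfl
      have hx0 : x₀ ≠ 0 := by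
        rw [hx₀v]; intro h'
        have := congrFun h' 0
        simp at this
      have hq := hpos 0 x₀ hx2 hx0
      rw [h0, dotProduct_zero] at hq
      exact lt_irrefl _ hq
    rcases (sum_sq_nonneg (Mb 0 *ᵥ x₀)).lt_or_eq with hlt | heq
    · exact hlt
    · exact absurd ((sum_sq_eq_zero_iff _).1 heq.symm) hne
  have horient : ∀ q ∈ hondaTube r₁, ∀ Ω : (EuclideanSpace ℝ (Fin 4)) [⋀^Fin 2]→L[ℝ] ℝ,
      0 < pfaffian (Ω.compContinuousLinearMap (flatDifferential χ q)) →
        o (χ q) = signOrientationIn 4 (pfaffian Ω) := fun q hq Ω hΩ ↦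
    tubeChart_orientation_of_isPositiveZero o hr₁ hχs₁ hχimm₁ hsm h0base hpzbase hWbase hq Ω hΩ
  -- `Pf Ω ≠ 0` from `Pf(Ω ∘ dχ) > 0`
  have hPfne : ∀ q ∈ hondaTube r₁, ∀ Ω : (EuclideanSpace ℝ (Fin 4)) [⋀^Fin 2]→L[ℝ] ℝ,
      0 < pfaffian (Ω.compContinuousLinearMap (flatDifferential χ q)) → pfaffian Ω ≠ 0 := by
    intro q hq Ω hΩ hPf
    rw [pfaffian_compContinuousLinearMap, hPf, mul_zero] at hΩ
    exact lt_irrefl _ hΩ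
  -- membership in the tube from the distance, and the distance on the tube
  have hnorm₁ : ∀ q ∈ hondaTube r₁, ‖q - hondaAxisPoint (q 0)‖ < r₁ := fun q hq ↦
    (mem_hondaTube_iff_norm_lt hr₁).1 hq
  -- Step 6: `χ^*sf' = Θ` near the axis, as an eventual identity of forms on `ℝ⁴`
  have hnear : ∀ q ∈ hondaTube r₁, ‖q - hondaAxisPoint (q 0)‖ < r₀ →
      ∀ᶠ z in 𝓝 q, (sf'.pullback 𝓘(ℝ, EuclideanSpace ℝ (Fin 4)) χ) z = hondaMForm z := by
    intro q hq hq0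
    filter_upwards [(isOpen_hondaTube r₁).mem_nhds hq,
      (isOpen_lt hdist continuous_const).mem_nhds hq0] with z hz hz0
    rw [hpull z hz, hG'core z hz0]
    rfl
  -- Step 7: the conclusions
  refine ⟨sf', r₀, χ, ⟨hsm' hsm, hcl' hcl, fun x ↦ ?_⟩, ?_, ?_, hr₀, ?_, hax⟩
  · -- STRICT NEAR-POSITIVITY
    by_cases hx : x ∈ χ '' hondaTube r₁
    · obtain ⟨q, hq, rfl⟩ := hx
      have hχq := eventually_contMDiffAt_of_mem_hondaTube hχs₁ hq
      have hbij := bijective_flatDifferential_of_injective (hχimm₁ q hq)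
      by_cases hqa : q ∈ hondaAxis
      · -- positive zero
        right
        have hq0 : ‖q - hondaAxisPoint (q 0)‖ < r₀ := by
          have hle : ¬ 0 < ‖q - hondaAxisPoint (q 0)‖ := fun h' ↦
            (norm_sub_hondaAxisPoint_pos_iff q).1 h' hqa
          exact lt_of_le_of_lt (not_lt.1 hle) hr₀
        have hev := hnear q hq hq0
        have hsf'sm : sf'.SmoothAt (χ q) := hsm' hsm (χ q)
        have h0' : sf' (χ q) = 0 := by
          refine (pullback_apply_eq_zero_iff (sf := sf') hbij.2).1 ?_
          rw [hpull q hq, hG'core q hq0]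
          exact (hondaFormCLM_eq_zero_iff q).2 hqa
        have hzG : zeroGradient (sf'.pullback 𝓘(ℝ, EuclideanSpace ℝ (Fin 4)) χ) q = hondaFormCLM := by
          rw [zeroGradient_congr_of_eventuallyEq hev, zeroGradient_hondaMForm]
        refine ⟨⟨h0', ?_⟩, fun v hv ↦ ?_⟩
        · rw [← finrank_range_zeroGradient_pullback hχq hsf'sm h0' hbij, hzG]
          exact finrank_range_hondaFormCLM
        · obtain ⟨W, rfl⟩ := hbij.2 v
          have hc := zeroGradient_pullback_eq_comp hχq hsf'sm h0' W
          rw [hzG] at hc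
          -- `hc : hondaFormCLM W = (∇_{dχ W} sf')∘(dχ × dχ)`
          have hWa : W ∉ hondaAxis := by
            intro hWa
            apply hv
            have h1 : hondaFormCLM W = 0 := (hondaFormCLM_eq_zero_iff W).2 hWa
            rw [h1] at hc
            exact (compContinuousLinearMap_eq_zero_iff _ hbij.2).1 hc.symm
          have hΩ : 0 < pfaffian ((zeroGradient sf' (χ q) (flatDifferential χ q W)).compContinuousLinearMap
              (flatDifferential χ q)) := by
            rw [← hc]
            exact pfaffian_hondaMForm_pos hWa
          exact ⟨hPfne q hq _ hΩ, horient q hq _ hΩ⟩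
      · -- wedge-square positive
        left
        have hd0 : 0 < ‖q - hondaAxisPoint (q 0)‖ := (norm_sub_hondaAxisPoint_pos_iff q).2 hqa
        have hPf : 0 < pfaffian ((sf' (χ q)).compContinuousLinearMap (flatDifferential χ q)) := by
          have key : (sf' (χ q)).compContinuousLinearMap (flatDifferential χ q) =
              sf'.pullback 𝓘(ℝ, EuclideanSpace ℝ (Fin 4)) χ q := rfl
          rw [key, hpull q hq]
          exact hG'pos q hd0 (hnorm₁ q hq).le
        exact ⟨hPfne q hq _ hPf, horient q hq _ hPf⟩
    · -- off the image of the tube: `sf' = sf` near `x`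
      have hx' : x ∉ χ '' {q | q ∈ hondaTube r₁ ∧ ‖q - hondaAxisPoint (q 0)‖ ≤ r₁ / 2} :=
        fun h' ↦ hx (hcoreSub h')
      have hev : ∀ᶠ w in 𝓝 x, sf' w = sf w := by
        filter_upwards [hcoreClosed.isOpen_compl.mem_nhds hx'] with w hw
        exact hcoreEq w hw
      rcases hsf.isStrictlyNearPositive x with hw | hp
      · exact Or.inl ((isWedgeSqPos_congr hev.self_of_nhds).2 hw)
      · exact Or.inr (hp.congr_of_eventuallyEq hev)
  · -- `sf' = sf` off `N`
    intro x hx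
    refine hcoreEq x fun h' ↦ hx ?_
    obtain ⟨q, hq, rfl⟩ := hcoreSub h'
    exact hχN ⟨q, hsub₁ hq, rfl⟩
  · -- zero locus
    ext x
    rw [mem_zeroLocus, mem_zeroLocus]
    by_cases hx : x ∈ χ '' hondaTube r₁
    · obtain ⟨q, hq, rfl⟩ := hx
      have hbij := bijective_flatDifferential_of_injective (hχimm₁ q hq)
      rw [← pullback_apply_eq_zero_iff (sf := sf') hbij.2, hpull q hq]
      constructor
      · intro hG'q
        -- `G' q = 0` forces `q` on the axis (positivity off the axis)
        by_contra hne
        have hqa : q ∉ hondaAxis := fun hqa ↦ hne (haxZ q hqa)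
        have hd0 : 0 < ‖q - hondaAxisPoint (q 0)‖ := (norm_sub_hondaAxisPoint_pos_iff q).2 hqa
        have := hG'pos q hd0 (hnorm₁ q hq).le
        have hG'q' : G' q = (0 : (EuclideanSpace ℝ (Fin 4)) [⋀^Fin 2]→L[ℝ] ℝ) := hG'q
        rw [hG'q', pfaffian_zero] at this
        exact lt_irrefl _ this
      · intro hsf0
        -- `sf (χ q) = 0` forces `q` on the axis, where `G' = 0`
        have hmem : χ q ∈ zeroLocus sf ∩ χ '' hondaTube r := ⟨mem_zeroLocus.2 hsf0, q, hsub₁ hq, rfl⟩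
        rw [hZ] at hmem
        obtain ⟨q', hq', hqq⟩ := hmem
        obtain ⟨k, hk⟩ := hχinj q' (hondaAxis_subset_hondaTube hr hq') q (hsub₁ hq) hqq.symm
        have hqa : q ∈ hondaAxis := by
          rw [hk, mem_hondaAxis]
          rw [mem_hondaAxis] at hq'
          simpa using hq'
        rw [eq_hondaAxisPoint_of_mem_hondaAxis hqa]
        exact hG'0 _
    · have hx' : x ∉ χ '' {q | q ∈ hondaTube r₁ ∧ ‖q - hondaAxisPoint (q 0)‖ ≤ r₁ / 2} :=
        fun h' ↦ hx (hcoreSub h')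
      rw [hcoreEq x hx']
  · -- the Honda model chart of radius `r₀`
    refine ⟨hper, hχs₁.mono hsub₀, fun q hq q' hq' hqq ↦ hχinj₁ q (hsub₀ hq) q' (hsub₀ hq') hqq,
      fun q hq ↦ hχimm₁ q (hsub₀ hq), ?_, ?_⟩
    · rintro _ ⟨q, hq, rfl⟩
      exact hχN ⟨q, hsub₁ (hsub₀ hq), rfl⟩
    · intro q hq U V
      have h1 : sf' (χ q) ![mfderiv 𝓘(ℝ, EuclideanSpace ℝ (Fin 4)) (𝓡 4) χ q U,
          mfderiv 𝓘(ℝ, EuclideanSpace ℝ (Fin 4)) (𝓡 4) χ q V] =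
          sf'.pullback 𝓘(ℝ, EuclideanSpace ℝ (Fin 4)) χ q ![U, V] := by
        rw [MForm.pullback_apply]
        congr 1
        funext i
        fin_cases i <;> rfl
      rw [h1, hpull q (hsub₀ hq), hG'core q ((mem_hondaTube_iff_norm_lt hr₀).1 hq)]
      exact hondaFormCLM_apply q U V

end Main

/-! ### The two-circle reduction: (H') discharged -/

/-- **(H') on a punctured homotopy `4`-sphere** — the hypothesis `hH` of
`relNearSymplecticTaubesTubes_exists_of_twoEvenCircles_of_hondaNormalForm_strict`, proved.
[cite: Perutz2006, Lemma 3.1] -/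
theorem hondaNormalForm_hH (S : Literature.Topology.FourManifolds.HomotopySphere 4) (p : S.carrier)
    (o : SmoothOrientation (𝓡 4) (punctured p)) (sf : MForm (𝓡 4) (punctured p) ℝ 2)
    (γ : ℝ → punctured p) (N : Set (punctured p))
    (hsf : IsStrictlyNearSymplectic o sf) (h : IsEvenZeroCircle sf γ) (hN : IsOpen N)
    (hγN : range γ ⊆ N) :
    ∃ (sf' : MForm (𝓡 4) (punctured p) ℝ 2) (r : ℝ) (χ : EuclideanSpace ℝ (Fin 4) → punctured p),
      IsStrictlyNearSymplectic o sf' ∧ (∀ x : punctured p, x ∉ N → sf' x = sf x) ∧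
      zeroLocus sf' = zeroLocus sf ∧ 0 < r ∧ IsHondaModelChartIn N r sf' χ ∧
      χ '' hondaAxis = range γ := by
  haveI : LocallyCompactSpace (punctured p) :=
    ChartedSpace.locallyCompactSpace (EuclideanSpace ℝ (Fin 4)) (punctured p)
  haveI : SigmaCompactSpace (punctured p) := sigmaCompactSpace_of_locallyCompact_secondCountable
  exact hondaNormalForm_strict o sf γ N hsf h hN hγN

/-- **The fact `relNearSymplecticTaubesTubes_exists` follows from (G') alone**: if on every
punctured homotopy `4`-sphere there is a strictly near-symplectic form, standard on a punctured
chart-ball, whose zero locus consists of two disjoint EVEN zero circles (Gerig 2021, Thm. 1.6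
with §3, first paragraph; Perutz 2006 / Luttinger surgery), then the Taubes-tube statement holds
— (H') being `hondaNormalForm_hH`. [cite: Gerig2021NoHomotopySphereInvariants, Thm. 1.6 and §3 (first par.)] -/
theorem relNearSymplecticTaubesTubes_exists_of_twoEvenCircles
    (hG : ∀ (S : Literature.Topology.FourManifolds.HomotopySphere 4) (p : S.carrier),
      ∃ (ε : ℝ) (o : SmoothOrientation (𝓡 4) (punctured p))
        (sf : MForm (𝓡 4) (punctured p) ℝ 2) (γ₁ γ₂ : ℝ → punctured p),
        0 < ε ∧ Metric.closedBall (extChartAt (𝓡 4) p p) ε ⊆ (extChartAt (𝓡 4) p).target ∧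
        IsStrictlyNearSymplectic o sf ∧ IsStandardOnBall p ε sf ∧
        IsEvenZeroCircle sf γ₁ ∧ IsEvenZeroCircle sf γ₂ ∧ Disjoint (range γ₁) (range γ₂) ∧
        zeroLocus sf = range γ₁ ∪ range γ₂) :
    relNearSymplecticTaubesTubes_exists :=
  relNearSymplecticTaubesTubes_exists_of_twoEvenCircles_of_hondaNormalForm_strict hG
    hondaNormalForm_hH

end Literature.Geometry.Symplectic

end
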